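import Mathlib.Probability.Distributions.Bernoulli
import Literature.Probability.Moments.EfronSteinProofs
import Literature.Probability.Percolation.BernoulliPercolation
import HarnessLib

/-!
# The Efron–Stein inequality for bond percolation functionals (bounded differences)

Topic `Literature/Probability/Percolation`. The tree's `EfronSteinInequality_holds`
(`Literature/Probability/Moments/EfronSteinProofs.lean`: Efron–Stein 1981 / Steele 1986 as printed
in Boucheron–Bousquet–Lugosi 2004, §2 Thm. 5, on a FINITE product probability space) transported to
the setting in which percolation uses it: a square-integrable function of the Bernoulli bond
configuration `ω ~ P_p = bondPercolation G p` which depends only on the edges of a finite set `F`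
(Kesten 1993 and Zhang / Rossignol–Théret use such variance bounds for passage times and maximal
flows; Grimmett 1999, §2 for the product structure of `P_p`).

* `infinitePi_efronStein` — Efron–Stein on an INFINITE product `⨂ᵢ μᵢ` for functions depending on
  finitely many coordinates (`DependsOn f s`): `Var f ≤ ½ Σ_{i ∈ s} ∫∫ (f x − f (x with xᵢ := y))²
  dμᵢ(y) d(⨂μ)(x)` — reduction to the finite product over `s` by Mathlib's `infinitePi_map_restrict`;
* `bondPercolation_efronStein` — for `f : BondConfig V → ℝ` measurable, square-integrable and
  determined by the finite edge set `F ⊆ E(G)` (`f ω = f (ω ∩ F)`):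
  `Var_p f ≤ ½ Σ_{e ∈ F} E_p[ p (f ω − f (ω ∪ {e}))² + (1 − p) (f ω − f (ω ∖ {e}))² ]`
  (resampling the edge `e`: the inner Bernoulli integral computed);
* `bondPercolation_variance_le_of_bounded_differences` — **bounded differences**: if opening a
  closed edge `e ∈ F` changes `f` by at most `c e`, then `Var_p f ≤ p (1 − p) Σ_{e ∈ F} (c e)²`
  (`P_p(e open) = p`).
-/

noncomputable section

namespace Literature.Probability.Percolation

open MeasureTheory ProbabilityTheory Measure unitInterval Literature.Probability.Moments
open scoped ENNReal

/-! ### Efron–Stein on an infinite product, for functions of finitely many coordinates -/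

section InfinitePi

variable {ι : Type*} {X : ι → Type*} [∀ i, MeasurableSpace (X i)]
  (μ : (i : ι) → Measure (X i)) [∀ i, IsProbabilityMeasure (μ i)]

omit [∀ i, MeasurableSpace (X i)] in
/-- Updating inside a finite window and restricting commute (coordinatewise). [folklore] -/
theorem updateFinset_update_restrict_apply [DecidableEq ι] (x₀ x : Π i, X i) (s : Finset ι)
    {i : ι} (hi : i ∈ s) (y : X i) {j : ι} (hj : j ∈ s) :
    Function.updateFinset x₀ s (Function.update (s.restrict x) ⟨i, hi⟩ y) j =
      Function.update x i y j := by
  simp only [Function.updateFinset_def, dif_pos hj]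
  by_cases hji : j = i
  · subst hji
    rw [Function.update_self, Function.update_self]
  · rw [Function.update_of_ne (fun h => hji (congrArg Subtype.val h)), Function.update_of_ne hji]
    rfl

/-- **Efron–Stein for functions of finitely many coordinates of an infinite product** (reduction of
`EfronSteinInequality_holds` to the finite product over `s` by `infinitePi_map_restrict`): if `f`
depends only on the coordinates in the finite set `s`, is measurable and square-integrable, then
`Var f ≤ ½ Σ_{i ∈ s} ∫ (∫ (f x − f (x with xᵢ := y))² dμᵢ(y)) d(⨂μ)(x)`.
[cite: BoucheronBousquetLugosi2004, §2 Thm 5] -/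
theorem infinitePi_efronStein [DecidableEq ι] {s : Finset ι} {f : (Π i, X i) → ℝ}
    (hfs : DependsOn f ↑s) (hfm : Measurable f) (hf2 : MemLp f 2 (infinitePi μ)) :
    variance f (infinitePi μ) ≤ (1 / 2 : ℝ) * ∑ i ∈ s,
      ∫ x, (∫ y, (f x - f (Function.update x i y)) ^ 2 ∂μ i) ∂infinitePi μ := by
  classical
  -- a base point
  have hne : ∀ i, Nonempty (X i) := fun i => by
    by_contra h
    rw [not_nonempty_iff] at h
    have h1 := measure_univ (μ := μ i)
    rw [Set.univ_eq_empty_iff.2 h, measure_empty] at h1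
    exact zero_ne_one h1
  let x₀ : Π i, X i := fun i => Classical.choice (hne i)
  -- the finite-dimensional reduction
  set π : Measure (Π i : ↥s, X i) := Measure.pi (fun i : ↥s => μ i) with hπ
  set g : (Π i : ↥s, X i) → ℝ := fun y => f (Function.updateFinset x₀ s y) with hg
  have hgf : ∀ x, g (s.restrict x) = f x := fun x =>
    hfs fun i hi => by
      have hi' : i ∈ s := Finset.mem_coe.1 hi
      simp [Function.updateFinset_def, hi']
  have hgm : Measurable g := hfm.comp measurable_updateFinset
  have hmp : MeasurePreserving (fun x : Π i, X i => s.restrict x) (infinitePi μ) π :=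
    ⟨Finset.measurable_restrict s, infinitePi_map_restrict μ⟩
  have hg2 : MemLp g 2 π := by
    rw [hπ, ← infinitePi_map_restrict μ]
    refine (memLp_map_measure_iff hgm.aestronglyMeasurable
      (Finset.measurable_restrict s).aemeasurable).2 ?_
    exact hf2.ae_eq (ae_of_all _ fun x => (hgf x).symm)
  -- Efron–Stein on the finite product
  have hES := EfronSteinInequality_holds (↥s) (fun i : ↥s => X i) (fun i : ↥s => μ i) g hgm hg2
  -- transport the variance
  have hvar : variance f (infinitePi μ) = variance g π := by
    have h1 := hmp.variance_fun_comp (f := g) hgm.aemeasurable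
    simp only [hgf] at h1
    exact h1
  rw [hvar]
  refine hES.trans (le_of_eq ?_)
  congr 1
  rw [← Finset.sum_coe_sort s]
  refine Finset.sum_congr rfl fun i _ => ?_
  -- transport each resampling term
  have hφ : AEStronglyMeasurable
      (fun y : Π j : ↥s, X j => ∫ z, (g y - g (Function.update y i z)) ^ 2 ∂μ i) π := by
    refine (StronglyMeasurable.integral_prod_right ?_).aestronglyMeasurable
    refine Measurable.stronglyMeasurable ?_
    exact ((hgm.comp measurable_fst).sub (hgm.comp (by fun_prop))).pow_const 2
  rw [← EfronStein.integral_comp_eq hmp hφ]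
  refine integral_congr_ae (ae_of_all _ fun x => ?_)
  dsimp only
  refine integral_congr_ae (ae_of_all _ fun z => ?_)
  dsimp only
  rw [hgf x]
  congr 2
  exact hfs fun j hj => updateFinset_update_restrict_apply x₀ x s i.2 z hj

end InfinitePi

/-! ### Transport to bond percolation -/

section Bond

variable {V : Type*}

/-- The configuration read off a truth assignment of the pairs: `{e | q e}`; opening the pair `e`
is `insert e`. [folklore] -/
theorem setOf_update_true (q : Sym2 V → Prop) (e : Sym2 V) [DecidableEq (Sym2 V)] :
    {e' | Function.update q e True e'} = insert e {e' | q e'} := by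
  ext e'
  simp only [Set.mem_setOf_eq, Set.mem_insert_iff]
  by_cases h : e' = e
  · subst h; simp
  · simp [h]

/-- Closing the pair `e` is `· \ {e}`. [folklore] -/
theorem setOf_update_false (q : Sym2 V → Prop) (e : Sym2 V) [DecidableEq (Sym2 V)] :
    {e' | Function.update q e False e'} = {e' | q e'} \ {e} := by
  ext e'
  simp only [Set.mem_setOf_eq, Set.mem_sdiff, Set.mem_singleton_iff]
  by_cases h : e' = e
  · subst h; simp
  · simp [h]

variable (G : SimpleGraph V) (p : unitInterval)

/-- **The Efron–Stein inequality for bond percolation functionals.** Let `f : BondConfig V → ℝ` be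
measurable, square-integrable under `P_p = bondPercolation G p`, and determined by a finite set `F` of
edges of `G` (`f ω = f (ω ∩ F)` for every `ω`). Then
`Var_p(f) ≤ ½ Σ_{e ∈ F} E_p[ p · (f(ω) − f(ω ∪ {e}))² + (1 − p) · (f(ω) − f(ω ∖ {e}))² ]`
— Boucheron–Bousquet–Lugosi 2004, §2 Thm. 5 with the independent copy of the coordinate `e`
integrated out (`P_p` is the product of Bernoulli(`p`) laws over `E(G)`, Grimmett 1999 §1.3).
[cite: BoucheronBousquetLugosi2004, §2 Thm 5] -/
theorem bondPercolation_efronStein (F : Finset (Sym2 V)) (hF : (↑F : Set (Sym2 V)) ⊆ G.edgeSet)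
    {f : BondConfig V → ℝ} (hfm : Measurable f) (hf2 : MemLp f 2 (bondPercolation G p))
    (hdet : ∀ ω, f ω = f (ω ∩ ↑F)) :
    variance f (bondPercolation G p) ≤ (1 / 2 : ℝ) * ∑ e ∈ F,
      ∫ ω, ((p : ℝ) * (f ω - f (insert e ω)) ^ 2 + (1 - p : ℝ) * (f ω - f (ω \ {e})) ^ 2)
        ∂bondPercolation G p := by
  classical
  -- `P_p = setOf_* (⨂ νₑ)`
  set ν : Sym2 V → Measure Prop := fun e =>
    toNNReal p • dirac (e ∈ G.edgeSet) + toNNReal (σ p) • dirac False with hν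
  have hνBer : ∀ e, ν e = Ber(e ∈ G.edgeSet, False, p) := fun e => rfl
  haveI : ∀ e, IsProbabilityMeasure (ν e) := fun e => by rw [hνBer]; infer_instance
  set S : (Sym2 V → Prop) → BondConfig V := fun q => {e | q e} with hS
  have hSm : Measurable S := measurable_setOf
  have hμ : bondPercolation G p = (infinitePi ν).map S := by
    rw [bondPercolation, setBernoulli_eq_map]
  have hmp : MeasurePreserving S (infinitePi ν) (bondPercolation G p) := ⟨hSm, hμ.symm⟩
  -- `f ∘ S` depends on the coordinates in `F`
  set g : (Sym2 V → Prop) → ℝ := fun q => f (S q) with hg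
  have hgm : Measurable g := hfm.comp hSm
  have hgs : DependsOn g ↑F := by
    intro q q' hqq'
    simp only [g]
    rw [hdet (S q), hdet (S q')]
    congr 1
    ext e
    simp only [S, Set.mem_inter_iff, Set.mem_setOf_eq, Finset.mem_coe]
    constructor
    · rintro ⟨hq, he⟩; exact ⟨(hqq' e he) ▸ hq, he⟩
    · rintro ⟨hq, he⟩; exact ⟨(hqq' e he).symm ▸ hq, he⟩
  have hg2 : MemLp g 2 (infinitePi ν) := hf2.comp_measurePreserving hmp
  -- Efron–Stein upstairs
  have hES := infinitePi_efronStein ν hgs hgm hg2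
  have hvar : variance f (bondPercolation G p) = variance g (infinitePi ν) :=
    (hmp.variance_fun_comp (f := f) hfm.aemeasurable).symm
  rw [hvar]
  refine hES.trans (le_of_eq ?_)
  congr 1
  refine Finset.sum_congr rfl fun e he => ?_
  -- the inner Bernoulli integral, and transport of the outer integral
  have heT : (e ∈ G.edgeSet) = True := propext ⟨fun _ => trivial, fun _ => hF he⟩
  have hinner : ∀ q : Sym2 V → Prop, ∫ y, (g q - g (Function.update q e y)) ^ 2 ∂ν e =
      (p : ℝ) * (f (S q) - f (insert e (S q))) ^ 2 + (1 - p : ℝ) * (f (S q) - f (S q \ {e})) ^ 2 := by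
    intro q
    rw [hνBer, heT, integral_bernoulliMeasure]
    simp only [g, S, smul_eq_mul, setOf_update_true, setOf_update_false]
  simp_rw [hinner]
  have hφ : AEStronglyMeasurable (fun ω : BondConfig V =>
      (p : ℝ) * (f ω - f (insert e ω)) ^ 2 + (1 - p : ℝ) * (f ω - f (ω \ {e})) ^ 2)
      (bondPercolation G p) := by
    -- `insert e` and `· ∖ {e}` are measurable maps of configurations (coordinatewise)
    have hins : Measurable fun ω : BondConfig V => insert e ω := by
      refine measurable_set_iff.2 fun e' => ?_
      simp only [Set.mem_insert_iff]
      exact measurable_const.or (measurable_set_mem e')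
    have hdel : Measurable fun ω : BondConfig V => ω \ {e} := by
      refine measurable_set_iff.2 fun e' => ?_
      simp only [Set.mem_sdiff, Set.mem_singleton_iff]
      exact (measurable_set_mem e').and measurable_const
    refine Measurable.aestronglyMeasurable ?_
    exact ((measurable_const.mul ((hfm.sub (hfm.comp hins)).pow_const 2)).add
      (measurable_const.mul ((hfm.sub (hfm.comp hdel)).pow_const 2)))
  exact EfronStein.integral_comp_eq hmp hφ

/-- **Variance bound under bounded differences.** If moreover opening a closed edge `e ∈ F` changes
`f` by at most `c e` (`|f(ω ∪ {e}) − f(ω)| ≤ c e` for `e ∉ ω`), then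
`Var_p(f) ≤ p (1 − p) Σ_{e ∈ F} (c e)²` (the `e`-th Efron–Stein term is `2p(1−p) E[(Δ_e f)²]`,
and `P_p(e open) = p`). [cite: BoucheronBousquetLugosi2004, §2 Thm 5 (bounded differences)] -/
theorem bondPercolation_variance_le_of_bounded_differences (F : Finset (Sym2 V))
    (hF : (↑F : Set (Sym2 V)) ⊆ G.edgeSet) {f : BondConfig V → ℝ} (hfm : Measurable f)
    (hf2 : MemLp f 2 (bondPercolation G p)) (hdet : ∀ ω, f ω = f (ω ∩ ↑F)) (c : Sym2 V → ℝ)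
    (hc : ∀ ω : BondConfig V, ∀ e ∈ F, e ∉ ω → |f (insert e ω) - f ω| ≤ c e) :
    variance f (bondPercolation G p) ≤ (p : ℝ) * (1 - p) * ∑ e ∈ F, c e ^ 2 := by
  refine (bondPercolation_efronStein G p F hF hfm hf2 hdet).trans ?_
  rw [Finset.mul_sum, Finset.mul_sum]
  refine Finset.sum_le_sum fun e he => ?_
  have hp0 : (0 : ℝ) ≤ p := p.2.1
  have hp1 : (0 : ℝ) ≤ 1 - p := sub_nonneg.2 p.2.2
  have hmeas : MeasurableSet {ω : BondConfig V | e ∈ ω} := (measurable_set_mem e).setOf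
  -- pointwise: the integrand is at most `c² (p 𝟙{e ∉ ω} + (1-p) 𝟙{e ∈ ω})`
  have hpt : ∀ ω : BondConfig V,
      (p : ℝ) * (f ω - f (insert e ω)) ^ 2 + (1 - p : ℝ) * (f ω - f (ω \ {e})) ^ 2 ≤
        c e ^ 2 * ((p : ℝ) * Set.indicator {ω : BondConfig V | e ∈ ω}ᶜ (fun _ => (1 : ℝ)) ω +
          (1 - p : ℝ) * Set.indicator {ω : BondConfig V | e ∈ ω} (fun _ => (1 : ℝ)) ω) := by
    intro ω
    by_cases heω : e ∈ ω
    · have h1 : insert e ω = ω := Set.insert_eq_of_mem heω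
      have h2 : insert e (ω \ {e}) = ω := by rw [Set.insert_sdiff_singleton, h1]
      have h3 : |f (insert e (ω \ {e})) - f (ω \ {e})| ≤ c e := hc _ e he (fun h => h.2 rfl)
      rw [h2] at h3
      have h4 : (f ω - f (ω \ {e})) ^ 2 ≤ c e ^ 2 := by
        rw [← sq_abs, ← sq_abs (c e)]
        exact pow_le_pow_left₀ (abs_nonneg _) (h3.trans (le_abs_self _)) 2
      simp only [h1, sub_self, zero_pow two_ne_zero, mul_zero, zero_add, Set.indicator_of_mem
        (show ω ∈ {ω : BondConfig V | e ∈ ω} from heω), Set.indicator_of_notMem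
        (show ω ∉ {ω : BondConfig V | e ∈ ω}ᶜ from fun h => h heω), mul_one]
      nlinarith
    · have h1 : ω \ {e} = ω := by
        rw [Set.sdiff_singleton_eq_self heω]
      have h3 : |f (insert e ω) - f ω| ≤ c e := hc ω e he heω
      have h4 : (f ω - f (insert e ω)) ^ 2 ≤ c e ^ 2 := by
        rw [← sq_abs, abs_sub_comm, ← sq_abs (c e)]
        exact pow_le_pow_left₀ (abs_nonneg _) (h3.trans (le_abs_self _)) 2
      simp only [h1, sub_self, zero_pow two_ne_zero, mul_zero, add_zero, Set.indicator_of_notMem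
        (show ω ∉ {ω : BondConfig V | e ∈ ω} from heω), Set.indicator_of_mem
        (show ω ∈ {ω : BondConfig V | e ∈ ω}ᶜ from heω), mul_one]
      nlinarith
  -- integrate: `∫ (p 𝟙{e ∉ ω} + (1-p) 𝟙{e ∈ ω}) dP_p = p(1-p) + (1-p)p`
  have hI1 : Integrable (fun ω : BondConfig V =>
      Set.indicator {ω : BondConfig V | e ∈ ω}ᶜ (fun _ => (1 : ℝ)) ω) (bondPercolation G p) :=
    (integrable_const (1 : ℝ)).indicator hmeas.compl
  have hI2 : Integrable (fun ω : BondConfig V =>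
      Set.indicator {ω : BondConfig V | e ∈ ω} (fun _ => (1 : ℝ)) ω) (bondPercolation G p) :=
    (integrable_const (1 : ℝ)).indicator hmeas
  have hint : Integrable (fun ω : BondConfig V => c e ^ 2 * ((p : ℝ) *
      Set.indicator {ω : BondConfig V | e ∈ ω}ᶜ (fun _ => (1 : ℝ)) ω +
        (1 - p : ℝ) * Set.indicator {ω : BondConfig V | e ∈ ω} (fun _ => (1 : ℝ)) ω))
      (bondPercolation G p) :=
    ((hI1.const_mul _).add (hI2.const_mul _)).const_mul _
  have hopen : (bondPercolation G p).real {ω : BondConfig V | e ∈ ω} = p :=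
    bondPercolation_cylinder G p (hF he)
  have hclosed : (bondPercolation G p).real {ω : BondConfig V | e ∈ ω}ᶜ = 1 - p := by
    rw [measureReal_compl hmeas, probReal_univ, hopen]
  have hval : ∫ ω, c e ^ 2 * ((p : ℝ) *
      Set.indicator {ω : BondConfig V | e ∈ ω}ᶜ (fun _ => (1 : ℝ)) ω +
        (1 - p : ℝ) * Set.indicator {ω : BondConfig V | e ∈ ω} (fun _ => (1 : ℝ)) ω)
      ∂bondPercolation G p = c e ^ 2 * (2 * p * (1 - p)) := by
    rw [integral_const_mul, integral_add (hI1.const_mul _) (hI2.const_mul _), integral_const_mul,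
      integral_const_mul, integral_indicator_const _ hmeas.compl, integral_indicator_const _ hmeas,
      smul_eq_mul, smul_eq_mul, mul_one, mul_one, hopen, hclosed]
    ring
  have hle := integral_mono_of_nonneg (ae_of_all _ fun ω => by positivity) hint (ae_of_all _ hpt)
  rw [hval] at hle
  nlinarith [hle, sq_nonneg (c e), mul_nonneg hp0 hp1]

end Bond

end Literature.Probability.Percolation
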